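import Summits.QuantumFields.YangMills.Theorems.BalabanUVNodesN09TowerAESocketsOfWindowOpenness
import Summits.QuantumFields.YangMills.Theorems.BalabanUVNodesN09TowerBasePointSocketsOfOpenness
import Summits.QuantumFields.YangMills.Theorems.BalabanUVNodesN09TowerOfPerBondCharts
import Summits.QuantumFields.YangMills.Theorems.BalabanUVNodesN09PerBondChartsOfForwardLawsSharp

/-!
# NODE N09 [B12] — ROAD A′ RUNS THE (F1) TOWER WITH NO CONTINUITY SOCKET LEFT AT THE CHART, AND FROM FORWARD JACOBIAN LAWS: `hreg_j` and (F3)_j for all `j < K` from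
# (§1) per-bond inversion data at the central `α`-windows, resp. (§2) the forward change-of-variables laws of the one-variable (0.4) averages with densities bounded below and
# continuous on the windows — plus window-interior openness (O-int), parametric openness at the critical configuration (O), N07, [B11]-existence and numerics

Cell `pub-ymgap` (YM-PLAN Track A), width seat `pub-ymgap-dag-n09-w5` g5 (D-0154 ∕ R399 (3a) width seat 5 of node N09), FILE 2; helper of K1⁹
`StabilityBRunRowsAtRecordR13SepCoPHV` = stmt-QuantumFields-27364 (`--supports`, `--as helper`, count-neutral).  [I] = [Balaban1987RG1] (CMP 109).

§1 — THE FOUR SOCKETS SUPPLIED.  This seat's g4 status theorem `…N09TowerOfPerBondCharts.hreg_pos_all_of_perBondCharts_centralWindow` (p630630) displayed EXACTLY four continuity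
sockets at road A′'s re-based chart `(Φ′, J′)`: `hΦV hJV` (a.e. continuity in the coarse field) and `hΦc hJpos` (continuity ∕ positivity at the base point `V^{(j)}(V)`).  They are
now THEOREMS: `hΦV hJV` = this seat's g5 FILE 1b `…N09TowerAESocketsOfWindowOpenness.tower_hΦV∕hJV_of_windowOpenness_of_hsolν_of_numerics` (interior∕boundary bookkeeping under
the STRICT margin; exceptional set dag-n09-w3 g5's threshold nullity p625076), `hΦc hJpos` = dag-n09-w6 g4's `…N09TowerBasePointSocketsOfOpenness.tower_hΦc∕hJpos_of_openness_of_hsolν_of_numerics`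
(p632316).  ★★★ `hreg_pos_all_of_perBondCharts_centralWindow_of_openness` re-runs the tower with all four supplied BY NAME (`hright` DERIVED from `hT` + `hleft`, FILE 1a).  Displayed
INSTEAD — the located residue of the private-coordinate road, sentences about the ONE-variable (0.4) average and its change-of-variables density, nobody's theorem yet:
* (O-int) «`Ū′(c)(Ωα c U)` is a neighbourhood of `Ū′(c)(g)` for every `g` STRICTLY inside the central `α`-window `Ωα c U`» (local openness at interior window points — NOTE for a
  supplier: the environment `U` is an ARBITRARY fine field (a.e.), so the inverse-function reading must run under the (0.4) guard AT `c` ONLY, which the window provides for `α < δ_N`);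
* (O) «for `V ∈ domAlt_{j+1}` and every coarse bond `c`, `{z | V c ∈ T_c(z)} ∈ 𝓝 (V^{(j)}(V))`» (parametric openness of the image windows at the critical configuration);
* (C-jd) `jd_c(U,·)` continuous on `T_c(U)` and (P) `jd_c(U,v) ≠ 0` there;
plus the per-bond inversion data themselves (`T ϑ jd` with `hΩm hTm hθm hjm hΩbl hT hlaw hleft`, `jd ≤ B`), `α < δ_N`, the STRICT margin `(((d+2)L)²∕4)·ε₀ < α`, [B11]-existence
`hsolν`, N07's `hcrit`, (H-U) `hU`, (I19) `hint` and dag-n09-w4 g3's numerics.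

§2 — FROM FORWARD LAWS.  dag-n09-w6 g4's sharp packaging `…N09PerBondChartsOfForwardLawsSharp.exists_perBondCharts_of_forwardLaws_sharp` (p633472) produces the per-bond
inversion data, per level, from the FORWARD change-of-variables laws `dg⌊Ū′(c)(Ωα c U) = Ū′(c)_*(jac_c(U,·)·dg⌊Ωα c U)` with jointly measurable densities non-vanishing on the
windows (Lusin–Souslin + closed graph ∕ compact fibre), and its `continuousOn_inverseDensity_of_formula` turns (Q) `jd = (jac ∘ ϑ)⁻¹` + continuity of `jac` into (C-jd).  ★★★
`hreg_pos_all_of_forwardLaws_of_openness` composes: the tower runs from the FORWARD laws.  Two book-keeping devices: (i) the uniform bound `jd ≤ B` — given a positive lower bound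
`m_c` of the forward density on the window graph (a jointly continuous non-vanishing density on the COMPACT graph `{(U, g) | g ∈ Ωα c U}` has one: `exists_pos_le_density_of_continuousOn_graph`),
replacing `jac_c` by `max(jac_c, m_c)` changes nothing on the window (neither the forward law — `forwardLaw_congr_max` — nor the continuity) while making `jd = (jac ∘ ϑ)⁻¹ ≤ m_c⁻¹`
everywhere; `B` is the finite maximum over `j < K`, `c`; (ii) TOTAL families over all levels `j` (the tower's measurability clauses are asked at every `j`) — junk data above `K`
(`T = ∅`, `ϑ = id`, `jd = 0`), measurable; the re-basing decidability is classical.  Displayed in §2 instead of the inversion data: the forward laws `hfwd` with densities `jac`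
(jointly measurable `hjacm` — dag-n09-w4 g5's `…N09CentralWindowForwardLawAtRecord.exists_jacobian_forwardLaws` is their announced supplier), a UNIFORM positive lower bound of
`jac_c` on the window graph (`hjaclb`, which carries the non-vanishing) and fibrewise continuity on the windows (`hjacc`), the window numerics `0 ≤ α ≤ 1∕24`, `offCard c∕|Idx| + 150·α < 1`.

WHAT IS PROVED (theorems only; 0 def, 0 instance, 0 notation, 0 sorry).  §1 `margin_two_εreg_le_of_hord` · ★★★ `hreg_pos_all_of_perBondCharts_centralWindow_of_openness`;
§2 `isCompact_centralWindowGraph` · ★ `exists_pos_le_density_of_continuousOn_graph` · `forwardLaw_congr_max` · ★★★ `hreg_pos_all_of_forwardLaws_of_openness`.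

HONEST FRAMING.  COMPOSITIONS BY NAME (count-neutral) + compactness bookkeeping; (O-int), (O), (C-jd)∕(P) resp. the forward laws and their densities with `hjaclb`∕`hjacc`, the
per-bond data resp. the window numerics, `hcrit` ([B11] Thm 1 for a continuous selector), `hsolν`, `hU`, `hint` and the numerics stay DISPLAYED hypotheses, asserted of NO record; NO
Jacobian law, NO openness, NO density continuity proved; NOTHING of Bałaban's proved or denied; `hreg` RE-SHAPED (now: forward Jacobian laws + a lower bound and fibrewise
continuity of the forward density + two openness sentences + N07 + numerics), NOT discharged; N09 NOT discharged; conjunct 1 (Lemma 4) and FLAG №7 untouched; K0⁷ ∕ K1⁹ ∕ K3⁸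
NOT closed; counts unmoved (typed 28∕28 · discharged 5∕28); no summit statement is proved by this seat; one finite four-torus programme at fixed `ε = L^{−K}` per run — R4 closes the
conditional rung `BalabanLadder.UV` only; NOT continuum ∕ ℝ⁴ ∕ infinite volume ∕ OS; the Yang–Mills mass gap (Clay) is NOT proved by any of this.
-/

noncomputable section

namespace Summit.QuantumFields.YangMills.BalabanUVNodes.N09TowerOfPerBondChartsOfWindowOpenness

open MeasureTheory Set Function Filter Topology
open scoped ENNReal NNReal
open Literature.MathematicalPhysics.QuantumFieldTheory.Balaban1983to89
open Literature.MathematicalPhysics.QuantumFieldTheory.Balaban1983to89.T4Continuum (T4Family)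
open Literature.MathematicalPhysics.QuantumFieldTheory.Balaban1983to89.Node00
open Literature.MathematicalPhysics.QuantumFieldTheory.Balaban1983to89.ExpMeanLog (deltaSU)
open Literature.MathematicalPhysics.QuantumFieldTheory.Balaban1983to89.FederbushMean (deltaFed)
open Literature.MathematicalPhysics.QuantumFieldTheory.Balaban1983to89.BlockAveraging (Idx)
open Literature.MathematicalPhysics.QuantumFieldTheory.Balaban1983to89.BlockAveragingHaarAC (centralBond pre post)
open Literature.MathematicalPhysics.QuantumFieldTheory.Balaban1983to89.BlockAveragingEMLHaarAC (fibreFamily offCard)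
open N09CentralWindowAtRecord (measurableSet_centralWindow centralWindow_extend)
open N09CentralWindowInverseContinuous (isClosed_centralWindowGraph isClosed_centralWindow)
open N09PerBondChartsOfForwardLawsSharp (exists_perBondCharts_of_forwardLaws_sharp continuousOn_inverseDensity_of_formula)
open N09StrictWindowMarginAtRecord (rightInverse_of_imageWindow_of_leftInverse)
open N09TowerAESocketsOfWindowOpenness (tower_hΦV_of_windowOpenness_of_hsolν_of_numerics tower_hJV_of_windowOpenness_of_hsolν_of_numerics)
open N09TowerBasePointSocketsOfOpenness (tower_hΦc_of_openness_of_hsolν_of_numerics tower_hJpos_of_openness_of_hsolν_of_numerics)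
open N09TowerOfPerBondCharts (hreg_pos_all_of_perBondCharts_centralWindow)
open N09LiftInvariance29AtRecord (succ_le_range_of_lt)

variable {F : T4Family} {N : ℕ} [NeZero N] {K j : ℕ}

/-! ## §1  The tower with its four chart sockets supplied -/

/-- The `2ε_reg∕L²`-margin letter of the base-point files follows from the threshold ordering `hord` and the `ε₀`-margin (`0 ≤ ε₂₉`).
[cite: Balaban1987RG1, Thm 3 p.264 and (0.19) p.255 (bookkeeping)] -/
theorem margin_two_εreg_le_of_hord (θ₀ : Stage13Params F N) (K : ℕ) (hε29 : 0 ≤ θ₀.ε₂₉)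
    (hord : 2 * θ₀.ν.εreg / ((F.P K).L : ℝ) ^ 2 +
      4 * max θ₀.ε₂₉ (10 * (((((F.P K).d + 2) * (F.P K).L : ℕ) : ℝ) * θ₀.ε₂₉) * ((F.P K).L : ℝ) ^ ((F.P K).d - 1)) ≤ θ₀.ν.ε₀)
    {α : ℝ} (hα : ((((F.P K).d + 2) * (F.P K).L : ℕ) : ℝ) ^ 2 / 4 * θ₀.ν.ε₀ ≤ α) :
    ((((F.P K).d + 2) * (F.P K).L : ℕ) : ℝ) ^ 2 / 4 * (2 * θ₀.ν.εreg / ((F.P K).L : ℝ) ^ 2) ≤ α := by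
  have h4 : 0 ≤ 4 * max θ₀.ε₂₉ (10 * (((((F.P K).d + 2) * (F.P K).L : ℕ) : ℝ) * θ₀.ε₂₉) * ((F.P K).L : ℝ) ^ ((F.P K).d - 1)) :=
    mul_nonneg (by norm_num) (hε29.trans (le_max_left _ _))
  have hδε : 2 * θ₀.ν.εreg / ((F.P K).L : ℝ) ^ 2 ≤ θ₀.ν.ε₀ := by linarith
  exact (mul_le_mul_of_nonneg_left hδε (by positivity)).trans hα

/-- ★★★ **ROAD A′ RUNS THE (F1) REGULARITY TOWER WITH NO CONTINUITY SOCKET LEFT AT THE CHART.**  At a Stage-13 parameter `θ₀`, torus `K`, history `g`, radius `α` with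
`α < δ_N` and the STRICT margin `(((d+2)L)²∕4)·ε₀ < α`: given per step `j < K` per-bond inversion data `(T j, ϑ j, jd j)` of the one-variable (0.4) averages at the central
`α`-windows (`hΩm hTm hθm hjm hΩbl`, the image-window clause `hT`, the inverse law `hlaw`, the left-inverse clause `hleft`, a bound `jd ≤ B`), window-interior openness (O-int),
parametric openness at the critical configuration (O), continuity (C-jd) and non-vanishing (P) of the inverse density on the image windows, [B11]-existence `hsolν`, N07's `hcrit`,
(H-U) `hU`, (I19) `hint` and numerics: for every `j < K`, `domAlt_{j+1} ⊆ regSetOfRecord K j ρ_j` (N09's `hreg_j`) and `T_jρ_j > 0` on `domAlt_{j+1}` ((F3)_j).  p630630 with its four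
sockets supplied by FILE 1b (`hΦV hJV`) and dag-n09-w6 g4's p632316 (`hΦc hJpos`); `hright` derived (FILE 1a).  CONDITIONAL; nothing of Bałaban's asserted; `hreg` NOT discharged.
[cite: Balaban1987RG1, p.259, (0.4) p.253, (0.19) p.255, (2.3)–(2.4) pp.265–266 and (2.9)–(2.10) pp.266–267; Balaban1985Averaging, (19) p.21 and Prop. 2 (53) p.26; Balaban1985Variational, Thm 1 (8)–(10) p.279] -/
theorem hreg_pos_all_of_perBondCharts_centralWindow_of_openness (θ₀ : Stage13Params F N) (K : ℕ) (g : ℕ → ℝ) {α : ℝ} (hαδ : α < deltaSU (Fin N))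
    (T : ∀ j, PBond (F.P K) (j + 1) → GaugeField (F.P K) j (SU N) → Set (SU N))
    (ϑ : ∀ j, PBond (F.P K) (j + 1) → GaugeField (F.P K) j (SU N) → SU N → SU N)
    (jd : ∀ j, PBond (F.P K) (j + 1) → GaugeField (F.P K) j (SU N) → SU N → ℝ≥0)
    (hΩm : ∀ j < K, ∀ c : PBond (F.P K) (j + 1),
      MeasurableSet {p : GaugeField (F.P K) j (SU N) × SU N | ∀ i : Idx (F.P K), dist1 (fibreFamily p.1 c (pre p.1 c * p.2 * post p.1 c) i) ≤ α})
    (hTm : ∀ j c, MeasurableSet {p : GaugeField (F.P K) j (SU N) × SU N | p.2 ∈ T j c p.1})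
    (hθm : ∀ j c, Measurable fun p : GaugeField (F.P K) j (SU N) × SU N => ϑ j c p.1 p.2)
    (hjm : ∀ j c, Measurable fun p : GaugeField (F.P K) j (SU N) × SU N => jd j c p.1 p.2)
    (hΩbl : ∀ j < K, ∀ (c : PBond (F.P K) (j + 1)) (U : GaugeField (F.P K) j (SU N)) (g' : PBond (F.P K) (j + 1) → SU N),
      {g : SU N | ∀ i : Idx (F.P K), dist1 (fibreFamily (extend centralBond g' U) c
          (pre (extend centralBond g' U) c * g * post (extend centralBond g' U) c) i) ≤ α} =
        {g : SU N | ∀ i : Idx (F.P K), dist1 (fibreFamily U c (pre U c * g * post U c) i) ≤ α})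
    (hT : ∀ j < K, ∀ c U, T j c U = (fun g => (avOfRecord F N K j).avg (update U (centralBond c) g) c) ''
        {g : SU N | ∀ i : Idx (F.P K), dist1 (fibreFamily U c (pre U c * g * post U c) i) ≤ α})
    (hlaw : ∀ j < K, ∀ (c : PBond (F.P K) (j + 1)) (U : GaugeField (F.P K) j (SU N)),
      (HaarData.haar : Measure (SU N)).restrict {g : SU N | ∀ i : Idx (F.P K), dist1 (fibreFamily U c (pre U c * g * post U c) i) ≤ α} =
        (((HaarData.haar : Measure (SU N)).restrict (T j c U)).withDensity fun v => (jd j c U v : ℝ≥0∞)).map (ϑ j c U))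
    (hleft : ∀ j < K, ∀ (c : PBond (F.P K) (j + 1)) (U : GaugeField (F.P K) j (SU N)) (g' : SU N),
      (∀ i : Idx (F.P K), dist1 (fibreFamily U c (pre U c * g' * post U c) i) ≤ α) →
        ϑ j c U ((avOfRecord F N K j).avg (update U (centralBond c) g') c) = g')
    {B : ℝ≥0} (hjdB : ∀ j < K, ∀ c U v, jd j c U v ≤ B)
    (hopenInt : ∀ j < K, ∀ (c : PBond (F.P K) (j + 1)) (U : GaugeField (F.P K) j (SU N)) (g : SU N),
      (∀ i : Idx (F.P K), dist1 (fibreFamily U c (pre U c * g * post U c) i) < α) →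
        (fun g' => (avOfRecord F N K j).avg (update U (centralBond c) g') c) ''
            {g' : SU N | ∀ i : Idx (F.P K), dist1 (fibreFamily U c (pre U c * g' * post U c) i) ≤ α} ∈
          𝓝 ((avOfRecord F N K j).avg (update U (centralBond c) g) c))
    (hopenCrit : ∀ j < K, ∀ V ∈ domAltOfRecord F N θ₀.ν K (j + 1), ∀ c,
      {z : GaugeField (F.P K) j (SU N) | V c ∈ T j c z} ∈ 𝓝 (critCfgOfRecord F N θ₀.ν K j V))
    (hjc : ∀ j < K, ∀ c U, ContinuousOn (jd j c U) (T j c U)) (hjd0 : ∀ j < K, ∀ c U v, v ∈ T j c U → jd j c U v ≠ 0)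
    (hεreg : 0 < θ₀.ν.εreg)
    (hε3 : (143 * (((((F.P K).d + 4 : ℕ) : ℝ)) ^ 2 / 4) ^ 2) * θ₀.ν.εreg ≤ 1 / 3)
    (hε2 : 2 * θ₀.ν.εreg ≤ 2 * deltaSU (Fin N) / ((((F.P K).d + 4) * (F.P K).L : ℕ) : ℝ) ^ 2) (hε29 : 0 < θ₀.ε₂₉)
    (hn1 : 1640 * (2 * (((((F.P K).d + 2) * (F.P K).L : ℕ) : ℝ) * θ₀.ε₂₉) +
        ((((F.P K).d + 2) * (F.P K).L : ℕ) : ℝ) ^ 2 / 4 * (2 * θ₀.ν.εreg / ((F.P K).L : ℝ) ^ 2)) * (((F.P K).L : ℝ) ^ ((F.P K).d - 1)) ^ 2 ≤ 1)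
    (hn2 : 13 * (2 * (((((F.P K).d + 2) * (F.P K).L : ℕ) : ℝ) * θ₀.ε₂₉) +
        ((((F.P K).d + 2) * (F.P K).L : ℕ) : ℝ) ^ 2 / 4 * (2 * θ₀.ν.εreg / ((F.P K).L : ℝ) ^ 2)) * ((F.P K).L : ℝ) ^ ((F.P K).d - 1) < deltaSU (Fin N))
    (hord : 2 * θ₀.ν.εreg / ((F.P K).L : ℝ) ^ 2 +
      4 * max θ₀.ε₂₉ (10 * (((((F.P K).d + 2) * (F.P K).L : ℕ) : ℝ) * θ₀.ε₂₉) * ((F.P K).L : ℝ) ^ ((F.P K).d - 1)) ≤ θ₀.ν.ε₀)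
    (hα : ((((F.P K).d + 2) * (F.P K).L : ℕ) : ℝ) ^ 2 / 4 * θ₀.ν.ε₀ < α)
    (hε₀ : 0 ≤ θ₀.ν.ε₀) (hnumF : ((((F.P K).d * (F.P K).L : ℕ) : ℝ)) ^ 2 / 4 * θ₀.ν.ε₀ < deltaFed (Fin N))
    (hsolν : ∀ j < K, ∀ W ∈ domAltOfRecord F N θ₀.ν K (j + 1), UkExists F N K (j + 1) θ₀.ν.εreg W)
    (hU : ∀ k, Measurable (Uk F N K (k + 1) θ₀.ν.εreg))
    (hint : ∀ j < K, Integrable (betaInputOfRecord F N (TcanOfRecord F N) (chiFixed29 F N θ₀.ν θ₀.ε₂₉) K g j) (fieldMeasure (F.P K) j (SU N)))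
    (hcrit : ∀ j < K, ContinuousOn (critCfgOfRecord F N θ₀.ν K j) (domAltOfRecord F N θ₀.ν K (j + 1)))
    [∀ j, DecidablePred (· ∈ {p : ((PBond (F.P K) (j + 1) → SU N) × GaugeField (F.P K) j (SU N)) |
          ({q : ((PBond (F.P K) (j + 1) → SU N) × GaugeField (F.P K) j (SU N)) | ∀ c, q.1 c ∈ T j c q.2}.indicator fun q => ∏ c, jd j c q.2 (q.1 c)) p ≠ 0 ∧
            (extend centralBond (fun c => ϑ j c p.2 (p.1 c)) p.2 : GaugeField (F.P K) j (SU N)) ∈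
              {U : GaugeField (F.P K) j (SU N) | chiFixed29 F N θ₀.ν θ₀.ε₂₉ K g j U ≠ 0}})] :
    ∀ j < K, domAltOfRecord F N θ₀.ν K (j + 1) ⊆ regSetOfRecord F N K j
        (betaInputOfRecord F N (TcanOfRecord F N) (chiFixed29 F N θ₀.ν θ₀.ε₂₉) K g j) ∧
      ∀ V ∈ domAltOfRecord F N θ₀.ν K (j + 1),
        0 < TcanOfRecord F N K j (betaInputOfRecord F N (TcanOfRecord F N) (chiFixed29 F N θ₀.ν θ₀.ε₂₉) K g j) V := by
  have hright : ∀ j < K, ∀ c U, ∀ v ∈ T j c U, (avOfRecord F N K j).avg (update U (centralBond c) (ϑ j c U v)) c = v :=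
    fun j hj => rightInverse_of_imageWindow_of_leftInverse (T j) (ϑ j) (hT j hj) (hleft j hj)
  have hα' : ((((F.P K).d + 2) * (F.P K).L : ℕ) : ℝ) ^ 2 / 4 * (2 * θ₀.ν.εreg / ((F.P K).L : ℝ) ^ 2) ≤ α :=
    margin_two_εreg_le_of_hord θ₀ K hε29.le hord hα.le
  exact hreg_pos_all_of_perBondCharts_centralWindow θ₀ K g T ϑ jd hΩm hTm hθm hjm hΩbl hright hlaw hleft hjdB hεreg hε3 hε2 hε29 hn1 hn2 hord hα.le hε₀ hnumF
    hsolν hU hint hcrit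
    (fun j hj => tower_hΦV_of_windowOpenness_of_hsolν_of_numerics θ₀ g (T j) (ϑ j) (jd j) hj hαδ (hT j hj) (hleft j hj) (hopenInt j hj) (hjc j hj) (hjd0 j hj)
      hεreg hε3 hε2 hε29 hn1 hn2 hord hsolν hα (hcrit j hj))
    (fun j hj => tower_hJV_of_windowOpenness_of_hsolν_of_numerics θ₀ g (T j) (ϑ j) (jd j) hj hαδ (hT j hj) (hleft j hj) (hopenInt j hj) (hjc j hj) (hjd0 j hj)
      hεreg hε3 hε2 hε29 hn1 hn2 hord hsolν hα (hcrit j hj))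
    (fun j hj => tower_hΦc_of_openness_of_hsolν_of_numerics (T j) (ϑ j) (jd j) θ₀.ν hε29 g hj hαδ (hT j hj) (hleft j hj) (hright j hj) (hjd0 j hj) (hopenCrit j hj)
      hεreg hε3 hε2 hα' hsolν)
    (fun j hj => tower_hJpos_of_openness_of_hsolν_of_numerics (T j) (ϑ j) (jd j) θ₀.ν hε29 g hj hαδ (hT j hj) (hleft j hj) (hright j hj) (hjd0 j hj) (hopenCrit j hj)
      hεreg hε3 hε2 hα' hsolν)

/-! ## §2  From forward laws: the window graph is compact; a jointly continuous non-vanishing density is bounded below there; the forward law does not see the modification off the window; the tower -/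

/-- The central `α`-window GRAPH `{(U, g) | g ∈ Ωα c U}` is COMPACT (closed — dag-n09-w6 g4's `isClosed_centralWindowGraph` — in the compact `SU(N)^{bonds_j} × SU(N)`).
[cite: Balaban1987RG1, (0.4) p.253 (bookkeeping)] -/
theorem isCompact_centralWindowGraph {P : Params} (c : PBond P (j + 1)) (α : ℝ) :
    IsCompact {p : GaugeField P j (SU N) × SU N | ∀ i : Idx P, dist1 (fibreFamily p.1 c (pre p.1 c * p.2 * post p.1 c) i) ≤ α} := by
  haveI : CompactSpace (GaugeField P j (SU N)) := inferInstanceAs (CompactSpace (PBond P j → SU N))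
  exact (isClosed_centralWindowGraph c α).isCompact

/-- ★ **A JOINTLY CONTINUOUS DENSITY NON-VANISHING ON THE WINDOW GRAPH IS UNIFORMLY BOUNDED BELOW THERE** (compactness: a positive minimum, or `1` on an empty graph).
[cite: Balaban1987RG1, (0.4) p.253 and (2.10) p.267 (bookkeeping); BourbakiGT1, Ch. I §9 no. 4, Thm 2 Cor. 2] -/
theorem exists_pos_le_density_of_continuousOn_graph {P : Params} (c : PBond P (j + 1)) (α : ℝ) (jac : GaugeField P j (SU N) → SU N → ℝ≥0)
    (hjacc : ContinuousOn (fun p : GaugeField P j (SU N) × SU N => jac p.1 p.2)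
      {p : GaugeField P j (SU N) × SU N | ∀ i : Idx P, dist1 (fibreFamily p.1 c (pre p.1 c * p.2 * post p.1 c) i) ≤ α})
    (hjac0 : ∀ U g, (∀ i : Idx P, dist1 (fibreFamily U c (pre U c * g * post U c) i) ≤ α) → jac U g ≠ 0) :
    ∃ m : ℝ≥0, 0 < m ∧ ∀ U g, (∀ i : Idx P, dist1 (fibreFamily U c (pre U c * g * post U c) i) ≤ α) → m ≤ jac U g := by
  by_cases hne : ({p : GaugeField P j (SU N) × SU N | ∀ i : Idx P, dist1 (fibreFamily p.1 c (pre p.1 c * p.2 * post p.1 c) i) ≤ α}).Nonempty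
  · obtain ⟨p₀, hp₀, hmin⟩ := (isCompact_centralWindowGraph c α).exists_isMinOn hne hjacc
    refine ⟨jac p₀.1 p₀.2, pos_iff_ne_zero.2 (hjac0 p₀.1 p₀.2 hp₀), fun U g hg => ?_⟩
    exact hmin (show ((U, g) : GaugeField P j (SU N) × SU N) ∈ {p : GaugeField P j (SU N) × SU N |
      ∀ i : Idx P, dist1 (fibreFamily p.1 c (pre p.1 c * p.2 * post p.1 c) i) ≤ α} from hg)
  · refine ⟨1, one_pos, fun U g hg => ?_⟩
    exact (hne ⟨(U, g), hg⟩).elim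

/-- **The forward law is blind to the modification `jac ↦ max(jac, m)` when `m ≤ jac` on the window** (the density is only integrated over the window).
[cite: Balaban1987RG1, (0.4) p.253 and (2.10) p.267 (bookkeeping)] -/
theorem forwardLaw_congr_max (c : PBond (F.P K) (j + 1)) (α : ℝ) (jac : GaugeField (F.P K) j (SU N) → SU N → ℝ≥0) {m : ℝ≥0}
    (hm : ∀ U g, (∀ i : Idx (F.P K), dist1 (fibreFamily U c (pre U c * g * post U c) i) ≤ α) → m ≤ jac U g) (U : GaugeField (F.P K) j (SU N))
    (hfwd : (HaarData.haar : Measure (SU N)).restrict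
        ((fun g => (avOfRecord F N K j).avg (update U (centralBond c) g) c) ''
          {g : SU N | ∀ i : Idx (F.P K), dist1 (fibreFamily U c (pre U c * g * post U c) i) ≤ α}) =
      (((HaarData.haar : Measure (SU N)).restrict {g : SU N | ∀ i : Idx (F.P K), dist1 (fibreFamily U c (pre U c * g * post U c) i) ≤ α}).withDensity
          fun g => (jac U g : ℝ≥0∞)).map (fun g => (avOfRecord F N K j).avg (update U (centralBond c) g) c)) :
    (HaarData.haar : Measure (SU N)).restrict
        ((fun g => (avOfRecord F N K j).avg (update U (centralBond c) g) c) ''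
          {g : SU N | ∀ i : Idx (F.P K), dist1 (fibreFamily U c (pre U c * g * post U c) i) ≤ α}) =
      (((HaarData.haar : Measure (SU N)).restrict {g : SU N | ∀ i : Idx (F.P K), dist1 (fibreFamily U c (pre U c * g * post U c) i) ≤ α}).withDensity
          fun g => (max (jac U g) m : ℝ≥0∞)).map (fun g => (avOfRecord F N K j).avg (update U (centralBond c) g) c) := by
  have hae : (fun g => (jac U g : ℝ≥0∞)) =ᵐ[(HaarData.haar : Measure (SU N)).restrict
      {g : SU N | ∀ i : Idx (F.P K), dist1 (fibreFamily U c (pre U c * g * post U c) i) ≤ α}] fun g => (max (jac U g) m : ℝ≥0∞) :=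
    ae_restrict_of_forall_mem (isClosed_centralWindow c α U).measurableSet fun g hg => by
      show (jac U g : ℝ≥0∞) = ((max (jac U g) m : ℝ≥0) : ℝ≥0∞)
      rw [max_eq_left (hm U g hg)]
  rw [hfwd, withDensity_congr_ae hae]

/-- ★★★ **ROAD A′ RUNS THE (F1) REGULARITY TOWER FROM FORWARD JACOBIAN LAWS.**  At a Stage-13 parameter `θ₀`, torus `K`, history `g`, radius `α` (`0 ≤ α ≤ 1∕24`, `α < δ_N`,
`offCard c∕|Idx| + 150·α < 1`, STRICT margin `(((d+2)L)²∕4)·ε₀ < α`): IF for every `j < K`, coarse bond `c` and environment `U` the FORWARD change-of-variables law of one-bond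
Haar measure under the one-variable (0.4) average `g ↦ Ū(U[β(c) ↦ g])(c)` holds on the central `α`-window with a density `jac_j c U ·` that is jointly measurable, POSITIVELY BOUNDED BELOW uniformly on the window graph (`hjaclb` — e.g. from joint
continuity + non-vanishing, `exists_pos_le_density_of_continuousOn_graph`) and continuous on each window (`hjacc`), IF the average is open at interior window points (O-int) and its image windows are parametrically open at the
critical configuration (O), and given [B11]-existence `hsolν`, N07's `hcrit`, (H-U) `hU`, (I19) `hint` and numerics — THEN for every `j < K`, `domAlt_{j+1} ⊆ regSetOfRecord K j ρ_j`
(N09's `hreg_j`) and `T_jρ_j > 0` on `domAlt_{j+1}` ((F3)_j).  §1 fed with dag-n09-w6 g4's sharp packaging (p633472) of the max-modified densities; the per-bond inversion data,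
their eleven clauses and the four chart sockets are NO LONGER hypotheses.  CONDITIONAL; nothing of Bałaban's asserted; `hreg` NOT discharged.
[cite: Balaban1987RG1, p.259, (0.4) p.253, (0.19) p.255, (2.3)–(2.4) pp.265–266 and (2.9)–(2.10) pp.266–267; Kechris1995, Thm 15.1 and Cor 15.2; Balaban1985Averaging, (19) p.21 and Prop. 2 (53) p.26; Balaban1985Variational, Thm 1 (8)–(10) p.279] -/
theorem hreg_pos_all_of_forwardLaws_of_openness (θ₀ : Stage13Params F N) (K : ℕ) (g : ℕ → ℝ) {α : ℝ} (hα0 : 0 ≤ α) (hα24 : α ≤ 1 / 24)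
    (hαδ : α < deltaSU (Fin N)) (hgap : ∀ j < K, ∀ c : PBond (F.P K) (j + 1), (offCard c : ℝ) / (Fintype.card (Idx (F.P K)) : ℝ) + 150 * α < 1)
    (jac : ∀ j, PBond (F.P K) (j + 1) → GaugeField (F.P K) j (SU N) → SU N → ℝ≥0)
    (hjacm : ∀ j < K, ∀ c, Measurable fun p : GaugeField (F.P K) j (SU N) × SU N => jac j c p.1 p.2)
    (hjaclb : ∀ j < K, ∀ c : PBond (F.P K) (j + 1), ∃ m : ℝ≥0, 0 < m ∧
      ∀ U g, (∀ i : Idx (F.P K), dist1 (fibreFamily U c (pre U c * g * post U c) i) ≤ α) → m ≤ jac j c U g)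
    (hjacc : ∀ j < K, ∀ c U, ContinuousOn (jac j c U) {g : SU N | ∀ i : Idx (F.P K), dist1 (fibreFamily U c (pre U c * g * post U c) i) ≤ α})
    (hfwd : ∀ j < K, ∀ c U, (HaarData.haar : Measure (SU N)).restrict
        ((fun g => (avOfRecord F N K j).avg (update U (centralBond c) g) c) ''
          {g : SU N | ∀ i : Idx (F.P K), dist1 (fibreFamily U c (pre U c * g * post U c) i) ≤ α}) =
      (((HaarData.haar : Measure (SU N)).restrict {g : SU N | ∀ i : Idx (F.P K), dist1 (fibreFamily U c (pre U c * g * post U c) i) ≤ α}).withDensity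
          fun g => (jac j c U g : ℝ≥0∞)).map (fun g => (avOfRecord F N K j).avg (update U (centralBond c) g) c))
    (hopenInt : ∀ j < K, ∀ (c : PBond (F.P K) (j + 1)) (U : GaugeField (F.P K) j (SU N)) (g : SU N),
      (∀ i : Idx (F.P K), dist1 (fibreFamily U c (pre U c * g * post U c) i) < α) →
        (fun g' => (avOfRecord F N K j).avg (update U (centralBond c) g') c) ''
            {g' : SU N | ∀ i : Idx (F.P K), dist1 (fibreFamily U c (pre U c * g' * post U c) i) ≤ α} ∈
          𝓝 ((avOfRecord F N K j).avg (update U (centralBond c) g) c))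
    (hopenCrit : ∀ j < K, ∀ V ∈ domAltOfRecord F N θ₀.ν K (j + 1), ∀ c : PBond (F.P K) (j + 1),
      {z : GaugeField (F.P K) j (SU N) | V c ∈ (fun g => (avOfRecord F N K j).avg (update z (centralBond c) g) c) ''
          {g : SU N | ∀ i : Idx (F.P K), dist1 (fibreFamily z c (pre z c * g * post z c) i) ≤ α}} ∈ 𝓝 (critCfgOfRecord F N θ₀.ν K j V))
    (hεreg : 0 < θ₀.ν.εreg)
    (hε3 : (143 * (((((F.P K).d + 4 : ℕ) : ℝ)) ^ 2 / 4) ^ 2) * θ₀.ν.εreg ≤ 1 / 3)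
    (hε2 : 2 * θ₀.ν.εreg ≤ 2 * deltaSU (Fin N) / ((((F.P K).d + 4) * (F.P K).L : ℕ) : ℝ) ^ 2) (hε29 : 0 < θ₀.ε₂₉)
    (hn1 : 1640 * (2 * (((((F.P K).d + 2) * (F.P K).L : ℕ) : ℝ) * θ₀.ε₂₉) +
        ((((F.P K).d + 2) * (F.P K).L : ℕ) : ℝ) ^ 2 / 4 * (2 * θ₀.ν.εreg / ((F.P K).L : ℝ) ^ 2)) * (((F.P K).L : ℝ) ^ ((F.P K).d - 1)) ^ 2 ≤ 1)
    (hn2 : 13 * (2 * (((((F.P K).d + 2) * (F.P K).L : ℕ) : ℝ) * θ₀.ε₂₉) +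
        ((((F.P K).d + 2) * (F.P K).L : ℕ) : ℝ) ^ 2 / 4 * (2 * θ₀.ν.εreg / ((F.P K).L : ℝ) ^ 2)) * ((F.P K).L : ℝ) ^ ((F.P K).d - 1) < deltaSU (Fin N))
    (hord : 2 * θ₀.ν.εreg / ((F.P K).L : ℝ) ^ 2 +
      4 * max θ₀.ε₂₉ (10 * (((((F.P K).d + 2) * (F.P K).L : ℕ) : ℝ) * θ₀.ε₂₉) * ((F.P K).L : ℝ) ^ ((F.P K).d - 1)) ≤ θ₀.ν.ε₀)
    (hα : ((((F.P K).d + 2) * (F.P K).L : ℕ) : ℝ) ^ 2 / 4 * θ₀.ν.ε₀ < α)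
    (hε₀ : 0 ≤ θ₀.ν.ε₀) (hnumF : ((((F.P K).d * (F.P K).L : ℕ) : ℝ)) ^ 2 / 4 * θ₀.ν.ε₀ < deltaFed (Fin N))
    (hsolν : ∀ j < K, ∀ W ∈ domAltOfRecord F N θ₀.ν K (j + 1), UkExists F N K (j + 1) θ₀.ν.εreg W)
    (hU : ∀ k, Measurable (Uk F N K (k + 1) θ₀.ν.εreg))
    (hint : ∀ j < K, Integrable (betaInputOfRecord F N (TcanOfRecord F N) (chiFixed29 F N θ₀.ν θ₀.ε₂₉) K g j) (fieldMeasure (F.P K) j (SU N)))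
    (hcrit : ∀ j < K, ContinuousOn (critCfgOfRecord F N θ₀.ν K j) (domAltOfRecord F N θ₀.ν K (j + 1))) :
    ∀ j < K, domAltOfRecord F N θ₀.ν K (j + 1) ⊆ regSetOfRecord F N K j
        (betaInputOfRecord F N (TcanOfRecord F N) (chiFixed29 F N θ₀.ν θ₀.ε₂₉) K g j) ∧
      ∀ V ∈ domAltOfRecord F N θ₀.ν K (j + 1),
        0 < TcanOfRecord F N K j (betaInputOfRecord F N (TcanOfRecord F N) (chiFixed29 F N θ₀.ν θ₀.ε₂₉) K g j) V := by
  -- (i) per level and bond, a positive uniform lower bound of the forward density on the window graph (junk `1` above `K`)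
  have hm : ∀ j (c : PBond (F.P K) (j + 1)), ∃ m : ℝ≥0, 0 < m ∧
      (j < K → ∀ U g, (∀ i : Idx (F.P K), dist1 (fibreFamily U c (pre U c * g * post U c) i) ≤ α) → m ≤ jac j c U g) := by
    intro j c
    by_cases hj : j < K
    · obtain ⟨m, hm0, hm⟩ := hjaclb j hj c
      exact ⟨m, hm0, fun _ => hm⟩
    · exact ⟨1, one_pos, fun h => (hj h).elim⟩
  choose m hm0 hm using hm
  -- the finite maximum of the reciprocal bounds
  obtain ⟨B, hB⟩ : ∃ B : ℝ≥0, ∀ j < K, ∀ c : PBond (F.P K) (j + 1), (m j c)⁻¹ ≤ B := by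
    obtain ⟨B, hB⟩ := (Set.finite_range (fun q : (Σ j : Fin K, PBond (F.P K) (j.1 + 1)) => (m q.1.1 q.2)⁻¹)).bddAbove
    exact ⟨B, fun j hj c => hB (Set.mem_range_self (⟨⟨j, hj⟩, c⟩ : Σ j : Fin K, PBond (F.P K) (j.1 + 1)))⟩
  -- (ii) the max-modified densities: measurable, non-vanishing everywhere, equal to `jac` on the windows
  have hjac'm : ∀ j < K, ∀ c, Measurable fun p : GaugeField (F.P K) j (SU N) × SU N => max (jac j c p.1 p.2) (m j c) :=
    fun j hj c => (hjacm j hj c).max measurable_const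
  have hjac'0 : ∀ j (c : PBond (F.P K) (j + 1)) (U : GaugeField (F.P K) j (SU N)) (g : SU N), max (jac j c U g) (m j c) ≠ 0 :=
    fun j c U g => (lt_of_lt_of_le (hm0 j c) (le_max_right _ _)).ne'
  have hjac'c : ∀ j < K, ∀ (c : PBond (F.P K) (j + 1)) (U : GaugeField (F.P K) j (SU N)),
      ContinuousOn (fun g => max (jac j c U g) (m j c)) {g : SU N | ∀ i : Idx (F.P K), dist1 (fibreFamily U c (pre U c * g * post U c) i) ≤ α} := by
    intro j hj c U
    exact (hjacc j hj c U).congr fun g hg => max_eq_left (hm j c hj U g hg)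
  -- (iii) per level: the sharp packaging of the modified forward laws (junk above `K`), as TOTAL families
  have hex : ∀ j, ∃ (T : PBond (F.P K) (j + 1) → GaugeField (F.P K) j (SU N) → Set (SU N))
      (ϑ : PBond (F.P K) (j + 1) → GaugeField (F.P K) j (SU N) → SU N → SU N)
      (jd : PBond (F.P K) (j + 1) → GaugeField (F.P K) j (SU N) → SU N → ℝ≥0),
      (∀ c, MeasurableSet {p : GaugeField (F.P K) j (SU N) × SU N | p.2 ∈ T c p.1}) ∧
      (∀ c, Measurable fun p : GaugeField (F.P K) j (SU N) × SU N => ϑ c p.1 p.2) ∧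
      (∀ c, Measurable fun p : GaugeField (F.P K) j (SU N) × SU N => jd c p.1 p.2) ∧
      (j < K →
        (∀ c U, (HaarData.haar : Measure (SU N)).restrict {g : SU N | ∀ i : Idx (F.P K), dist1 (fibreFamily U c (pre U c * g * post U c) i) ≤ α} =
          (((HaarData.haar : Measure (SU N)).restrict (T c U)).withDensity fun v => (jd c U v : ℝ≥0∞)).map (ϑ c U)) ∧
        (∀ c U, T c U = (fun g => (avOfRecord F N K j).avg (update U (centralBond c) g) c) ''
          {g : SU N | ∀ i : Idx (F.P K), dist1 (fibreFamily U c (pre U c * g * post U c) i) ≤ α}) ∧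
        (∀ c U g, (∀ i : Idx (F.P K), dist1 (fibreFamily U c (pre U c * g * post U c) i) ≤ α) →
          ϑ c U ((avOfRecord F N K j).avg (update U (centralBond c) g) c) = g) ∧
        (∀ c U, ∀ v ∈ T c U, ∀ i : Idx (F.P K), dist1 (fibreFamily U c (pre U c * ϑ c U v * post U c) i) ≤ α) ∧
        (∀ c U v, jd c U v = (max (jac j c U (ϑ c U v)) (m j c))⁻¹) ∧
        (∀ c U, ∀ v ∈ T c U, jd c U v ≠ 0) ∧
        (∀ c, ContinuousOn (fun q : GaugeField (F.P K) j (SU N) × SU N => ϑ c q.1 q.2) {q : GaugeField (F.P K) j (SU N) × SU N | q.2 ∈ T c q.1})) := by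
    intro j
    by_cases hj : j < K
    · obtain ⟨T, ϑ, jd, -, -, h3, h4, h5, -, h7, h8, h9, h10, h11, h12, -, h14, -, -⟩ :=
        exists_perBondCharts_of_forwardLaws_sharp (F := F) (N := N) hj hα0 hα24 hαδ (hgap j hj) (fun c U g => max (jac j c U g) (m j c)) (hjac'm j hj)
          (fun c U g _ => hjac'0 j c U g) fun c U => forwardLaw_congr_max c α (jac j c) (hm j c hj) U (hfwd j hj c U)
      exact ⟨T, ϑ, jd, h3, h4, h5, fun _ => ⟨h7, h8, h9, h10, h11, h12, h14⟩⟩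
    · refine ⟨fun _ _ => ∅, fun _ _ v => v, fun _ _ _ => 0, fun c => ?_, fun c => measurable_snd, fun c => measurable_const, fun h => (hj h).elim⟩
      have hset : {p : GaugeField (F.P K) j (SU N) × SU N | p.2 ∈ (∅ : Set (SU N))} = ∅ := by ext p; simp
      rw [hset]; exact MeasurableSet.empty
  choose T ϑ jd hTm hθm hjm hspec using hex
  haveI : ∀ j, DecidablePred (· ∈ {p : ((PBond (F.P K) (j + 1) → SU N) × GaugeField (F.P K) j (SU N)) |
      ({q : ((PBond (F.P K) (j + 1) → SU N) × GaugeField (F.P K) j (SU N)) | ∀ c, q.1 c ∈ T j c q.2}.indicator fun q => ∏ c, jd j c q.2 (q.1 c)) p ≠ 0 ∧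
        (extend centralBond (fun c => ϑ j c p.2 (p.1 c)) p.2 : GaugeField (F.P K) j (SU N)) ∈
          {U : GaugeField (F.P K) j (SU N) | chiFixed29 F N θ₀.ν θ₀.ε₂₉ K g j U ≠ 0}}) := fun j => Classical.decPred _
  -- (iv) the tower, §1
  refine hreg_pos_all_of_perBondCharts_centralWindow_of_openness θ₀ K g hαδ T ϑ jd (fun j _ c => measurableSet_centralWindow c α) hTm hθm hjm
    (fun j hj c U g' => centralWindow_extend (succ_le_range_of_lt hj) c α U g') (fun j hj => (hspec j hj).2.1) (fun j hj => (hspec j hj).1)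
    (fun j hj => (hspec j hj).2.2.1) (B := B) ?_ hopenInt ?_ ?_ (fun j hj => (hspec j hj).2.2.2.2.2.1) hεreg hε3 hε2 hε29 hn1 hn2 hord hα hε₀ hnumF hsolν hU hint hcrit
  · -- `jd ≤ B`
    intro j hj c U v
    rw [(hspec j hj).2.2.2.2.1 c U v]
    exact (inv_anti₀ (hm0 j c) (le_max_right _ _)).trans (hB j hj c)
  · -- (O) along `hT`
    intro j hj V hV c
    have hset : {z : GaugeField (F.P K) j (SU N) | V c ∈ T j c z} = {z : GaugeField (F.P K) j (SU N) | V c ∈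
        (fun g => (avOfRecord F N K j).avg (update z (centralBond c) g) c) '' {g : SU N | ∀ i : Idx (F.P K), dist1 (fibreFamily z c (pre z c * g * post z c) i) ≤ α}} := by
      ext z; rw [mem_setOf_eq, mem_setOf_eq, (hspec j hj).2.1 c z]
    rw [hset]
    exact hopenCrit j hj V hV c
  · -- (C-jd) from (Q) + (C2) sliced + the modified density's fibrewise continuity
    intro j hj
    exact continuousOn_inverseDensity_of_formula (T j) (ϑ j) (jd j) (fun c U g => max (jac j c U g) (m j c)) (hspec j hj).2.2.2.2.1 (hspec j hj).2.2.2.1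
      (fun c U => ((hspec j hj).2.2.2.2.2.2 c).comp (continuous_const.prodMk continuous_id).continuousOn fun v hv => hv)
      (fun c U g _ => hjac'0 j c U g) (hjac'c j hj)

end Summit.QuantumFields.YangMills.BalabanUVNodes.N09TowerOfPerBondChartsOfWindowOpenness

end
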